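import Literature.Computability.AlgebraicComplexity.AlgDetRepr
import Literature.Computability.AlgebraicComplexity.PermanentMonotone
import HarnessLib

/-!
# `(m, s)`-representations are stable under projection; monotonicity in `n` for the permanent

Helper file for the pieces `PolySizeQPAlgebra` (stmt-ValiantsHypothesis-8064) and `AbelianizationQP`
(stmt-8063) of route `GrenetZeon`.  The Literature file `DeterminantalComplexityProofs.lean` proves
that affine determinantal representations (`s = 1`) pass to projections
(`HasDetRepr.of_isProjection_holds`, Bürgisser 2000 §2.5).  Here the two-parameter version: if
`f = λ(det A)` over a coefficient algebra `R` and `g = f(a)` is a projection of `f` (each variable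
replaced by a variable or a constant — more generally by any affine form), then `g = λ(det A(a))`
over the SAME `(R, λ)`: substitution by polynomials with coefficients in the ground field commutes
with reading coefficients through `λ` (`coeff_aeval_eq_coeff_aeval_mapCoord`).

Consequence for the permanent family: `HasAlgDetRepr (per_n) m s → HasAlgDetRepr (per_k) m s`
for `k ≤ n` (`per_k` is a projection of `per_n`, `isProjection_perPoly_of_le`), so every
exclusion statement of the piece `PolySizeQPAlgebra` at `per_k` propagates upward in `n` for fixed
`(m, s)`, and every representation found by the crux `AbelianizationQP` at `per_n` serves all
smaller permanents.

## Main results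

* `mapCoord_monomial`, `coeff_aeval_eq_coeff_aeval_mapCoord` — coefficientwise functionals
  commute with substitution of ground-field polynomials.
* `hasAlgDetRepr_aeval_affine` — stability under substitution of affine forms.
* `hasAlgDetRepr_of_isProjection` — stability under projection (Bürgisser's sense).
* `hasAlgDetRepr_perPoly_of_le` — monotonicity in `n` for the permanent.

This file is route-independent (no `Theses` import).  No stub is closed; `VP ≠ VNP` is not
touched.

## References

* P. Bürgisser, *Completeness and Reduction in Algebraic Complexity Theory* (2000), §2.5
  (projections and determinantal representations). [cite: Burgisser2000, §2.5]
* P. Hrubeš, A. Yehudayoff, *Arithmetic complexity in ring extensions*, Theory of Computing 7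
  (2011), §2. [cite: HrubesYehudayoff2011, §2]
-/

set_option linter.dupNamespace false

noncomputable section

namespace Summit.ValiantsHypothesis.ValiantsHypothesis.Theorems.GrenetZeonPolySizeQPAlgebra

open MvPolynomial Matrix
open Literature.Computability.AlgebraicComplexity

universe u v w

section Projection

variable {K : Type u} [Field K] {σ : Type v} {τ : Type w}

/-- A coefficientwise functional sends monomials to monomials:
`λ_* (monomial e r) = monomial e (λ r)`. [folklore] -/
theorem mapCoord_monomial {R : Type*} [CommRing R] [Algebra K R] (l : R →ₗ[K] K) (e : σ →₀ ℕ)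
    (r : R) :
    (AddMonoidAlgebra.map l.toAddMonoidHom (monomial e r) : MvPolynomial σ K) = monomial e (l r) := by
  rw [← single_eq_monomial, ← single_eq_monomial, AddMonoidAlgebra.map_single]
  rfl

/-- **Coefficientwise functionals commute with ground-field substitutions.** For a `K`-linear
`λ : R → K`, a polynomial `p` over `R` and a substitution `xᵢ ↦ aᵢ` by polynomials `aᵢ` with
coefficients in `K`: reading the coefficients of `p(a)` through `λ` gives the coefficients of
`(λ_* p)(a)`. (Both sides are additive in `p`; on a monomial `r x^e` both give `λ(r) · a^e`.)
[folklore] -/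
theorem coeff_aeval_eq_coeff_aeval_mapCoord {R : Type*} [CommRing R] [Algebra K R]
    (l : R →ₗ[K] K) (a : σ → MvPolynomial τ K) (p : MvPolynomial σ R) (d : τ →₀ ℕ) :
    l (coeff d (aeval (fun i => MvPolynomial.map (algebraMap K R) (a i)) p)) =
      coeff d (aeval a (AddMonoidAlgebra.map l.toAddMonoidHom p : MvPolynomial σ K)) := by
  induction p using MvPolynomial.induction_on' with
  | monomial e r =>
    rw [mapCoord_monomial, aeval_monomial, aeval_monomial, MvPolynomial.algebraMap_eq,
      MvPolynomial.algebraMap_eq, coeff_C_mul, coeff_C_mul]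
    have hprod : (e.prod fun i k => (MvPolynomial.map (algebraMap K R) (a i)) ^ k) =
        MvPolynomial.map (algebraMap K R) (e.prod fun i k => a i ^ k) := by
      rw [Finsupp.prod, Finsupp.prod, map_prod]
      simp only [map_pow]
    rw [hprod, coeff_map, mul_comm r, ← Algebra.smul_def, map_smul, smul_eq_mul, mul_comm]
  | add p q hp hq =>
    rw [AddMonoidAlgebra.map_add, map_add, coeff_add, map_add, hp, hq, map_add, coeff_add]

/-- **Stability of `(m, s)`-representations under affine substitution.** If `f` has an
`(m, s)`-representation and every `aᵢ` is an affine form over `K`, then `f(a)` has an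
`(m, s)`-representation over the same coefficient algebra: substitute into the matrix (entries
stay affine, `HasDetRepr.totalDegree_aeval_le_of_le_one`; `det` commutes with the substitution,
`AlgHom.map_det`) and keep `λ` (`coeff_aeval_eq_coeff_aeval_mapCoord`). [cite: Burgisser2000, §2.5] -/
theorem hasAlgDetRepr_aeval_affine {f : MvPolynomial σ K} {m s : ℕ} (h : HasAlgDetRepr f m s)
    (a : σ → MvPolynomial τ K) (ha : ∀ i, (a i).totalDegree ≤ 1) :
    HasAlgDetRepr (aeval a f) m s := by
  obtain ⟨R, _, _, _, hR, l, A, hA, hf⟩ := h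
  let aR : σ → MvPolynomial τ R := fun i => MvPolynomial.map (algebraMap K R) (a i)
  have haR : ∀ i, (aR i).totalDegree ≤ 1 := fun i =>
    (Finset.sup_mono (MvPolynomial.support_map_subset _ (a i))).trans (ha i)
  have hfeq : (AddMonoidAlgebra.map l.toAddMonoidHom A.det : MvPolynomial σ K) = f :=
    MvPolynomial.ext _ _ fun e => hf e
  refine ⟨R, inferInstance, inferInstance, inferInstance, hR, l, (aeval aR).mapMatrix A,
    fun i j => ?_, fun d => ?_⟩
  · rw [AlgHom.mapMatrix_apply, Matrix.map_apply]
    exact (HasDetRepr.totalDegree_aeval_le_of_le_one aR haR _).trans (hA i j)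
  · rw [← AlgHom.map_det, coeff_aeval_eq_coeff_aeval_mapCoord, hfeq]

/-- **Stability under projection** (Bürgisser: each variable replaced by a variable or a
constant): a projection `g` of `f` inherits every `(m, s)`-representation of `f`, with the same
coefficient algebra and functional.  The two-parameter analogue of
`HasDetRepr.of_isProjection_holds`. [cite: Burgisser2000, §2.5] -/
theorem hasAlgDetRepr_of_isProjection {f : MvPolynomial σ K} {g : MvPolynomial τ K} {m s : ℕ}
    (h : HasAlgDetRepr f m s) (hg : IsProjection g f) : HasAlgDetRepr g m s := by
  obtain ⟨a, ha, rfl⟩ := hg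
  refine hasAlgDetRepr_aeval_affine h a fun i => ?_
  rcases ha i with ⟨j, hj⟩ | ⟨c, hc⟩
  · rw [hj, totalDegree_X]
  · rw [hc, totalDegree_C]
    exact Nat.zero_le _

/-- **Monotonicity in `n` for the permanent.** `per_k` is a projection of `per_n` for `k ≤ n`
(`isProjection_perPoly_of_le`), so an `(m, s)`-representation of `per_n` yields one of `per_k`
with the same parameters: exclusions in the box of `PolySizeQPAlgebra` propagate upward in `n`
at fixed `(m, s)`, constructions downward. [cite: Burgisser2000, §2.5] -/
theorem hasAlgDetRepr_perPoly_of_le {k n m s : ℕ} (hkn : k ≤ n)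
    (h : HasAlgDetRepr (perPoly (Fin n) K) m s) : HasAlgDetRepr (perPoly (Fin k) K) m s :=
  hasAlgDetRepr_of_isProjection h (isProjection_perPoly_of_le K hkn)

/-- Contrapositive census form: if `per_k` has NO `(m, s)`-representation then neither has any
`per_n`, `n ≥ k`. [cite: Burgisser2000, §2.5] -/
theorem not_hasAlgDetRepr_perPoly_of_le {k n m s : ℕ} (hkn : k ≤ n)
    (h : ¬ HasAlgDetRepr (perPoly (Fin k) K) m s) : ¬ HasAlgDetRepr (perPoly (Fin n) K) m s :=
  fun hn => h (hasAlgDetRepr_perPoly_of_le hkn hn)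

end Projection

end Summit.ValiantsHypothesis.ValiantsHypothesis.Theorems.GrenetZeonPolySizeQPAlgebra

end
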